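import Literature.Topology.FourManifolds.SurfaceGroupNielsenCoreCuts
import Literature.GroupTheory.CombinatorialGroupTheory.BinaryProductChains
import HarnessLib

/-!
# Nielsen's theorem, pillar CORE: occurrence vertices, block values and the decomposition contradiction

Topic `Literature/Topology/FourManifolds`.  Helper layer (F4c) shared by all cut cases of the
minimal-counterexample form of Zieschang's homotopic shortening theorem (Zieschang–Vogt–Coldewey,
LNM 835, proof of Thm. 5.3.2 and Lemma 5.3.4), for the configurations `κ : Config φ` of
`SurfaceGroupNielsenCoreFrame.lean` with value words `κ.U` (`SurfaceGroupNielsenCoreReduced.lean`)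
and kernel start positions `κ.Kstart` (`SurfaceGroupNielsenCoreCuts.lean`):

* `Config.occStart κ j` — the **start vertex** `E_j ∈ S_g` of occurrence `j` (the image in `S_g`
  of the product of the first `j` values); `occStart_succ`, `occStart_length`, and the value of a
  block of consecutive letters as `E_{j₁}⁻¹ E_{j₂}` (`block_proj_eq`, `proj_lift_block`);
* `Config.absv κ i` — the **absolute vertex** of position `i` of the closed path
  `C = closedPath κ.U` (the prefix vertex `pv C i` translated by the head of the first factor, so
  that occurrences and the closed path live in the same copy of the Cayley graph); under the
  cyclic Nielsen property: `absv_Kstart` (*the kernel of occurrence `j` starts at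
  `E_j · head_j`*), `absv_Kstart_add`, `absv_kpos` (*the occurrence path: the vertex after `q`
  letters of occurrence `j` is `E_j · (fac j)[0, q)`*), the spur identities at a junction
  (`occStart_succ_eq_absv_mul_tail`, `absv_Kstart_succ_eq_occStart_mul_head`), and the block
  value as *head · path segment · (head)⁻¹* (`prod_block_eq_conj`, `prod_block_eq_head_mul_tail`);
* the **decomposition contradiction** `false_of_trivial_block` (ZVC 5.3.1 (b): a non-empty
  proper symbol-closed block of consecutive letters with trivial value contradicts the
  indecomposability of `φ` — the marking of `κ` composed with an inner automorphism is an exact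
  marking of `κ.w`), its wrap-around version `false_of_trivial_block_wrap` (via the rotated
  configuration), the vertex forms `false_of_occStart_eq`, `false_of_occStart_eq_wrap`, and the
  symbol-closedness of blocks that are unions of partner pairs (`blockClosed_of_bar`,
  `wrapBlockClosed_of_bar`).

## References

* H. Zieschang, E. Vogt, H.-D. Coldewey, *Surfaces and Planar Discontinuous Groups*, LNM 835
  (1980), §5.3 (5.3.1, proof of Thm. 5.3.2, Lemma 5.3.4). [ZieschangVogtColdewey1980]
* H. Zieschang, *Alternierende Produkte in freien Gruppen II*, Abh. Math. Sem. Univ. Hamburg 28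
  (1965) 219–233. [Zieschang1965]
-/

noncomputable section

/-! ## Blocks of a concatenation indexed by `range`: prefixes and segments -/

namespace Literature.GroupTheory.CombinatorialGroupTheory

namespace CycFactors

open List

variable {β : Type*} (F : ℕ → List β)

/-- The first `blockStart F j` letters of `F 0 ++ ⋯ ++ F (n-1)` are `F 0 ++ ⋯ ++ F (j-1)`.
[folklore] -/
theorem take_flatMap_range_blockStart {j n : ℕ} (hj : j ≤ n) :
    ((List.range n).flatMap F).take (blockStart F j) = (List.range j).flatMap F := by
  induction n, hj using Nat.le_induction with
  | base => rw [← length_flatMap_range F j, take_length]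
  | succ n hjn ih =>
    rw [range_succ, flatMap_append, take_append_of_le_length
      (by rw [length_flatMap_range]; exact blockStart_mono F hjn), ih]

/-- A prefix ending inside the `j`-th block. [folklore] -/
theorem take_flatMap_range_blockStart_add {j n t : ℕ} (hj : j < n) (ht : t ≤ (F j).length) :
    ((List.range n).flatMap F).take (blockStart F j + t) =
      (List.range j).flatMap F ++ (F j).take t := by
  have h1 : ((List.range n).flatMap F).take (blockStart F (j + 1)) =
      (List.range j).flatMap F ++ F j := by
    rw [take_flatMap_range_blockStart F hj, range_succ, flatMap_append, flatMap_singleton]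
  have h2 : blockStart F j + t ≤ blockStart F (j + 1) := by rw [blockStart_succ]; omega
  calc ((List.range n).flatMap F).take (blockStart F j + t)
      = (((List.range n).flatMap F).take (blockStart F (j + 1))).take (blockStart F j + t) := by
        rw [take_take, Nat.min_eq_left h2]
    _ = (List.range j).flatMap F ++ (F j).take t := by
        rw [h1, take_append, take_of_length_le (by rw [length_flatMap_range]; omega),
          length_flatMap_range, Nat.add_sub_cancel_left]

/-- A segment starting at the `j`-th block and ending inside it. [folklore] -/
theorem take_drop_flatMap_range_blockStart {j n t : ℕ} (hj : j < n) (ht : t ≤ (F j).length) :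
    (((List.range n).flatMap F).drop (blockStart F j)).take t = (F j).take t := by
  rw [take_drop, take_flatMap_range_blockStart_add F hj ht, drop_left' (length_flatMap_range F j)]

end CycFactors

end Literature.GroupTheory.CombinatorialGroupTheory

namespace Literature.Topology.FourManifolds

open Literature.GroupTheory.CombinatorialGroupTheory List

namespace SurfaceGroup

variable {g : ℕ}

/-! ## Letters of prefixes, suffixes and segments -/

/-- A member of a prefix is a letter with small index. [folklore] -/
theorem exists_getElem_of_mem_take {α : Type*} {l : List α} {n : ℕ} {x : α} (h : x ∈ l.take n) :
    ∃ (i : ℕ) (hi : i < l.length), i < n ∧ l[i] = x := by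
  obtain ⟨i, hi, rfl⟩ := getElem_of_mem h
  rw [length_take] at hi
  exact ⟨i, by omega, by omega, getElem_take.symm⟩

/-- A member of a suffix is a letter with large index. [folklore] -/
theorem exists_getElem_of_mem_drop {α : Type*} {l : List α} {n : ℕ} {x : α} (h : x ∈ l.drop n) :
    ∃ (i : ℕ) (hi : i < l.length), n ≤ i ∧ l[i] = x := by
  obtain ⟨i, hi, rfl⟩ := getElem_of_mem h
  rw [length_drop] at hi
  exact ⟨n + i, by omega, by omega, getElem_drop.symm⟩

/-- A member of a segment is a letter with index in the corresponding interval. [folklore] -/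
theorem exists_getElem_of_mem_drop_take {α : Type*} {l : List α} {a n : ℕ} {x : α}
    (h : x ∈ (l.drop a).take n) : ∃ (i : ℕ) (hi : i < l.length), a ≤ i ∧ i < a + n ∧ l[i] = x := by
  obtain ⟨i, hi, hin, rfl⟩ := exists_getElem_of_mem_take h
  rw [length_drop] at hi
  exact ⟨a + i, by omega, by omega, by omega, getElem_drop.symm⟩

namespace Config

variable {φ : surfaceGen g → SurfaceGroup g}

/-! ## Products of values as images of words under `Ŷ` -/

/-- The product of the values of the letters of a word is `Ŷ` of the word. [folklore] -/
theorem prod_map_lift_sgen (κ : Config φ) (L : List (surfaceGen g × Bool)) :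
    (L.map fun x => FreeGroup.lift κ.Y (sgen x.1 x.2)).prod = FreeGroup.lift κ.Y (FreeGroup.mk L) := by
  rw [lift_mk_eq_prod_map_val]
  congr 1
  exact map_congr_left fun x _ => lift_sgen κ.Y x

/-- A segment of the values is the list of values of the corresponding segment of the word.
[folklore] -/
theorem vals_drop_take (κ : Config φ) (j n : ℕ) :
    (κ.vals.drop j).take n = ((κ.w.drop j).take n).map fun x => FreeGroup.lift κ.Y (sgen x.1 x.2) := by
  rw [vals, map_take, map_drop]

/-- **Block value** (B1): the product of the values of a block of consecutive letters is `Ŷ` of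
the block. [cite: ZieschangVogtColdewey1980, 5.2.1] -/
theorem prod_block_eq_lift (κ : Config φ) (j n : ℕ) :
    ((κ.vals.drop j).take n).prod = FreeGroup.lift κ.Y (FreeGroup.mk ((κ.w.drop j).take n)) := by
  rw [vals_drop_take, prod_map_lift_sgen]

/-- The product of the first `j` values is `Ŷ` of the prefix. [folklore] -/
theorem prod_take_eq_lift (κ : Config φ) (j : ℕ) :
    (κ.vals.take j).prod = FreeGroup.lift κ.Y (FreeGroup.mk (κ.w.take j)) := by
  rw [vals, ← map_take, prod_map_lift_sgen]

/-- The product of the values after the first `j` is `Ŷ` of the suffix. [folklore] -/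
theorem prod_drop_eq_lift (κ : Config φ) (j : ℕ) :
    (κ.vals.drop j).prod = FreeGroup.lift κ.Y (FreeGroup.mk (κ.w.drop j)) := by
  rw [vals, ← map_drop, prod_map_lift_sgen]

/-- The `j`-th value is the free-group element of the `j`-th factor. [folklore] -/
theorem getElem_vals_eq_mk_fac (κ : Config φ) {j : ℕ} (hj : j < κ.vals.length) :
    κ.vals[j] = FreeGroup.mk (CycFactors.fac κ.U j) := by
  have hjU : j < κ.U.length := by rw [length_U]; rwa [length_vals] at hj
  rw [CycFactors.fac_eq_getElem _ hjU]
  simp only [U, getElem_map, FreeGroup.mk_toWord]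

/-! ## Start vertices of the occurrences -/

/-- **Start vertex** `E_j` of occurrence `j`: the image in `S_g` of the product of the first `j`
values (so that occurrence `j` is the path from `E_j` to `E_{j+1}` reading the `j`-th value word).
[cite: ZieschangVogtColdewey1980, proof of Thm. 5.3.2] -/
def occStart (κ : Config φ) (j : ℕ) : SurfaceGroup g := proj g (κ.vals.take j).prod

/-- `E_0 = 1`. [folklore] -/
@[simp] theorem occStart_zero (κ : Config φ) : κ.occStart 0 = 1 := by
  simp [occStart]

/-- `E_{j+1} = E_j · v_j`. [folklore] -/
theorem occStart_succ (κ : Config φ) {j : ℕ} (hj : j < κ.w.length) :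
    κ.occStart (j + 1) = κ.occStart j * proj g (κ.vals[j]'(by rw [length_vals]; exact hj)) := by
  rw [occStart, occStart, take_succ_eq_append_getElem (by rw [length_vals]; exact hj), prod_append,
    prod_singleton, map_mul]

/-- `E_{j+1} = E_j · mk (fac U j)`. [folklore] -/
theorem occStart_succ_eq_mul_fac (κ : Config φ) {j : ℕ} (hj : j < κ.w.length) :
    κ.occStart (j + 1) = κ.occStart j * proj g (FreeGroup.mk (CycFactors.fac κ.U j)) := by
  rw [occStart_succ κ hj, getElem_vals_eq_mk_fac]

/-- `E_m` is the image of the value of the configuration. [folklore] -/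
theorem occStart_length (κ : Config φ) : κ.occStart κ.w.length = proj g κ.value := by
  rw [occStart, ← length_vals, take_length, value_eq_prod]

/-- Beyond `m` the start vertex is `E_m`. [folklore] -/
theorem occStart_of_length_le (κ : Config φ) {j : ℕ} (hj : κ.w.length ≤ j) :
    κ.occStart j = proj g κ.value := by
  rw [occStart, take_of_length_le (by rw [length_vals]; exact hj), value_eq_prod]

/-- `E_j` is the image of `Ŷ` of the prefix of length `j`. [folklore] -/
theorem occStart_eq_proj_lift (κ : Config φ) (j : ℕ) :
    κ.occStart j = proj g (FreeGroup.lift κ.Y (FreeGroup.mk (κ.w.take j))) := by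
  rw [occStart, prod_take_eq_lift]

/-- The first `j₂` values split at `j₁ ≤ j₂`. [folklore] -/
theorem prod_take_eq_prod_take_mul_prod_block (κ : Config φ) {j₁ j₂ : ℕ} (h12 : j₁ ≤ j₂) :
    (κ.vals.take j₂).prod = (κ.vals.take j₁).prod * ((κ.vals.drop j₁).take (j₂ - j₁)).prod := by
  rw [← prod_append, ← take_add, Nat.add_sub_cancel' h12]

/-- **Block value between start vertices** (V1): the image of the product of the values
`v_{j₁} ⋯ v_{j₂ - 1}` is `E_{j₁}⁻¹ E_{j₂}`. [cite: ZieschangVogtColdewey1980, proof of Thm. 5.3.2] -/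
theorem block_proj_eq (κ : Config φ) {j₁ j₂ : ℕ} (h12 : j₁ ≤ j₂) :
    proj g ((κ.vals.drop j₁).take (j₂ - j₁)).prod = (κ.occStart j₁)⁻¹ * κ.occStart j₂ := by
  rw [occStart, occStart, prod_take_eq_prod_take_mul_prod_block κ h12, map_mul, inv_mul_cancel_left]

/-- Block value between start vertices, `Ŷ` form. [cite: ZieschangVogtColdewey1980, proof of Thm. 5.3.2] -/
theorem proj_lift_block (κ : Config φ) {j₁ j₂ : ℕ} (h12 : j₁ ≤ j₂) :
    proj g (FreeGroup.lift κ.Y (FreeGroup.mk ((κ.w.drop j₁).take (j₂ - j₁)))) =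
      (κ.occStart j₁)⁻¹ * κ.occStart j₂ := by
  rw [← prod_block_eq_lift, block_proj_eq κ h12]

/-- Equal start vertices give a block of trivial value. [folklore] -/
theorem proj_lift_block_eq_one (κ : Config φ) {j₁ j₂ : ℕ} (h12 : j₁ ≤ j₂)
    (he : κ.occStart j₁ = κ.occStart j₂) :
    proj g (FreeGroup.lift κ.Y (FreeGroup.mk ((κ.w.drop j₁).take (j₂ - j₁)))) = 1 := by
  rw [proj_lift_block κ h12, he, inv_mul_cancel]

/-- The image of the product of the values after the first `j₁`. [folklore] -/
theorem proj_prod_drop (κ : Config φ) (j₁ : ℕ) :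
    proj g (κ.vals.drop j₁).prod = (κ.occStart j₁)⁻¹ * κ.occStart κ.w.length := by
  have h : (κ.vals.take j₁).prod * (κ.vals.drop j₁).prod = (κ.vals.take κ.w.length).prod := by
    rw [← prod_append, take_append_drop, ← length_vals, take_length]
  rw [occStart, occStart, ← h, map_mul, inv_mul_cancel_left]

/-- **Wrap-around block value**: the image of `Ŷ` of the cyclic block `w[j₁, m) ++ w[0, j₂)` is
`E_{j₁}⁻¹ E_m E_{j₂}`. [cite: ZieschangVogtColdewey1980, proof of Thm. 5.3.2] -/
theorem proj_lift_wrapBlock (κ : Config φ) (j₁ j₂ : ℕ) :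
    proj g (FreeGroup.lift κ.Y (FreeGroup.mk (κ.w.drop j₁ ++ κ.w.take j₂))) =
      (κ.occStart j₁)⁻¹ * κ.occStart κ.w.length * κ.occStart j₂ := by
  rw [mk_append, map_mul, map_mul, ← prod_drop_eq_lift, ← prod_take_eq_lift, proj_prod_drop]
  rfl

/-! ## The decomposition contradiction -/

/-- **Decomposition contradiction, split form**: if the word of a configuration of an
indecomposable assignment splits as `A ++ P ++ B` with `P` non-empty, `A ++ B` non-empty, no
symbol shared between `P` and `A ++ B`, then the value `Ŷ(P)` is non-trivial in `S_g` — for the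
marking `θ` composed with the inner automorphism by `c⁻¹` is an exact marking of `w`
(`c⁻¹ θ(w) c = r`) and `φ̂ (c⁻¹ θ(P) c)` is conjugate to `proj (Ŷ P)`.
[cite: ZieschangVogtColdewey1980, 5.3.1 (b)] -/
theorem false_of_trivial_block_append (hI : Indecomposable φ) (κ : Config φ)
    (A P B : List (surfaceGen g × Bool)) (hw : κ.w = A ++ P ++ B)
    (hclosed : ∀ x ∈ P, ∀ y ∈ A ++ B, x.1 ≠ y.1) (hP : P ≠ []) (hAB : A ++ B ≠ [])
    (hval : proj g (FreeGroup.lift κ.Y (FreeGroup.mk P)) = 1) : False := by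
  -- the exact marking of `w`
  have hmark : (κ.θ.trans (MulAut.conj (κ.c)⁻¹)) (FreeGroup.mk (A ++ P ++ B)) = surfaceRelator g := by
    rw [← hw, MulEquiv.trans_apply, MulAut.conj_apply, κ.marking]
    group
  have hq : IsQuadratic (A ++ P ++ B) := hw ▸ κ.isQuadratic_w
  refine hI _ A P B hmark hq hclosed hP hAB ?_
  have h := DFunLike.congr_fun κ.proj_comp_lift (FreeGroup.mk P)
  simp only [MonoidHom.coe_comp, Function.comp_apply, MulEquiv.coe_toMonoidHom] at h
  rw [MulEquiv.trans_apply, MulAut.conj_apply, inv_inv, map_mul, map_mul, ← h, hval, mul_one, map_inv,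
    inv_mul_cancel]

/-- **The decomposition contradiction** (B2): for a configuration of an indecomposable
assignment, a non-empty proper block `w[j₁, j₂)` of consecutive letters which shares no symbol
with its complement cannot have trivial value in `S_g`.
[cite: ZieschangVogtColdewey1980, 5.3.1 (b) and proof of Thm. 5.3.2] -/
theorem false_of_trivial_block (hI : Indecomposable φ) (κ : Config φ) {j₁ j₂ : ℕ}
    (h12 : j₁ < j₂) (h2 : j₂ ≤ κ.w.length) (hproper : j₂ - j₁ < κ.w.length)
    (hclosed : ∀ x ∈ (κ.w.drop j₁).take (j₂ - j₁), ∀ y ∈ κ.w.take j₁ ++ κ.w.drop j₂, x.1 ≠ y.1)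
    (hval : proj g (FreeGroup.lift κ.Y (FreeGroup.mk ((κ.w.drop j₁).take (j₂ - j₁)))) = 1) :
    False := by
  refine false_of_trivial_block_append hI κ (κ.w.take j₁) ((κ.w.drop j₁).take (j₂ - j₁))
    (κ.w.drop j₂) ?_ hclosed ?_ ?_ hval
  · conv_lhs => rw [← take_append_drop j₁ κ.w, ← take_append_drop (j₂ - j₁) (κ.w.drop j₁)]
    rw [drop_drop, Nat.add_sub_cancel' h12.le, append_assoc]
  · rw [Ne, ← length_eq_zero_iff, length_take, length_drop]
    omega
  · rw [Ne, ← length_eq_zero_iff, length_append, length_take, length_drop]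
    omega

/-- **The decomposition contradiction, wrap-around version**: for `j₂ < j₁ ≤ m` the cyclic block
`w[j₁, m) ++ w[0, j₂)` (non-empty: `j₁ - j₂ < m`), sharing no symbol with its complement
`w[j₂, j₁)`, cannot have trivial value — by the linear version for the rotated configuration.
[cite: ZieschangVogtColdewey1980, 5.3.1 (b) and proof of Thm. 5.3.2] -/
theorem false_of_trivial_block_wrap (hI : Indecomposable φ) (κ : Config φ) {j₁ j₂ : ℕ}
    (h21 : j₂ < j₁) (h1 : j₁ ≤ κ.w.length) (hproper : j₁ - j₂ < κ.w.length)
    (hclosed : ∀ x ∈ κ.w.drop j₁ ++ κ.w.take j₂, ∀ y ∈ (κ.w.drop j₂).take (j₁ - j₂), x.1 ≠ y.1)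
    (hval : proj g (FreeGroup.lift κ.Y (FreeGroup.mk (κ.w.drop j₁ ++ κ.w.take j₂))) = 1) :
    False := by
  refine false_of_trivial_block_append hI (κ.rotateCfg j₂) ((κ.w.drop j₂).take (j₁ - j₂))
    (κ.w.drop j₁ ++ κ.w.take j₂) [] ?_ (by simpa only [append_nil] using hclosed) ?_ ?_
    (by simpa only [rotateCfg_Y] using hval)
  · rw [rotateCfg_w, rotate_eq_drop_append_take (by omega), append_nil, ← append_assoc]
    congr 1
    conv_lhs => rw [← take_append_drop (j₁ - j₂) (κ.w.drop j₂)]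
    rw [drop_drop, Nat.add_sub_cancel' h21.le]
  · rw [Ne, ← length_eq_zero_iff, length_append, length_take, length_drop]
    omega
  · rw [append_nil, Ne, ← length_eq_zero_iff, length_take, length_drop]
    omega

/-- **Decomposition contradiction, vertex form**: equal start vertices `E_{j₁} = E_{j₂}` of a
non-empty proper symbol-closed block are impossible. [cite: ZieschangVogtColdewey1980, proof of Thm. 5.3.2] -/
theorem false_of_occStart_eq (hI : Indecomposable φ) (κ : Config φ) {j₁ j₂ : ℕ}
    (h12 : j₁ < j₂) (h2 : j₂ ≤ κ.w.length) (hproper : j₂ - j₁ < κ.w.length)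
    (hclosed : ∀ x ∈ (κ.w.drop j₁).take (j₂ - j₁), ∀ y ∈ κ.w.take j₁ ++ κ.w.drop j₂, x.1 ≠ y.1)
    (he : κ.occStart j₁ = κ.occStart j₂) : False :=
  false_of_trivial_block hI κ h12 h2 hproper hclosed (κ.proj_lift_block_eq_one h12.le he)

/-- **Decomposition contradiction, wrap-around vertex form**: if the closed path is closed
(`E_m = 1`), equal start vertices `E_{j₁} = E_{j₂}` (`j₂ < j₁`) of a non-empty symbol-closed
cyclic block `w[j₁, m) ++ w[0, j₂)` are impossible. [cite: ZieschangVogtColdewey1980, proof of Thm. 5.3.2] -/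
theorem false_of_occStart_eq_wrap (hI : Indecomposable φ) (κ : Config φ) {j₁ j₂ : ℕ}
    (h21 : j₂ < j₁) (h1 : j₁ ≤ κ.w.length) (hproper : j₁ - j₂ < κ.w.length)
    (hclosed : ∀ x ∈ κ.w.drop j₁ ++ κ.w.take j₂, ∀ y ∈ (κ.w.drop j₂).take (j₁ - j₂), x.1 ≠ y.1)
    (hv : proj g κ.value = 1) (he : κ.occStart j₁ = κ.occStart j₂) : False :=
  false_of_trivial_block_wrap hI κ h21 h1 hproper hclosed
    (by rw [proj_lift_wrapBlock, occStart_length, hv, mul_one, he, inv_mul_cancel])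

/-! ## Symbol-closed blocks from the pairing -/

/-- **Uniqueness of the partner index**: a letter with the symbol of the `k`-th letter sits at
`k` or at `bar k`. [folklore] -/
theorem eq_or_eq_bar_of_fst_eq (κ : Config φ) {k k' : ℕ} (hk : k < κ.w.length)
    (hk' : k' < κ.w.length) (h : (κ.w[k']).1 = (κ.w[k]).1) : k' = k ∨ k' = κ.bar k := by
  rcases Bool.eq_or_eq_not (κ.w[k']).2 (κ.w[k]).2 with h2 | h2
  · left
    exact (κ.nodup_w.getElem_inj_iff).1 (Prod.ext h h2)
  · right
    have e : κ.w[k'] = κ.w[κ.bar k]'(κ.bar_lt hk) := by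
      rw [getElem_bar κ hk]
      exact Prod.ext h h2
    exact (κ.nodup_w.getElem_inj_iff).1 e

/-- The symbol of the partner letter. [folklore] -/
theorem fst_getElem_bar (κ : Config φ) {k : ℕ} (hk : k < κ.w.length)
    (h : κ.bar k < κ.w.length := κ.bar_lt hk) : (κ.w[κ.bar k]).1 = (κ.w[k]).1 := by
  rw [getElem_bar κ hk]

/-- **A set of indices closed under the pairing is symbol-closed**: its letters share no symbol
with the other letters. [cite: ZieschangVogtColdewey1980, 5.3.1 (b)] -/
theorem fst_ne_of_bar_closed (κ : Config φ) {S : ℕ → Prop}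
    (hS : ∀ k, k < κ.w.length → S k → S (κ.bar k)) {k k' : ℕ} (hk : k < κ.w.length)
    (hk' : k' < κ.w.length) (h1 : S k) (h2 : ¬ S k') : (κ.w[k]).1 ≠ (κ.w[k']).1 := by
  intro h
  rcases κ.eq_or_eq_bar_of_fst_eq hk hk' h.symm with rfl | rfl
  · exact h2 h1
  · exact h2 (hS k hk h1)

/-- **Symbol-closedness of a linear block** (B3): if the partner of every index of `[j₁, j₂)`
lies in `[j₁, j₂)`, the block `w[j₁, j₂)` shares no symbol with its complement.
[cite: ZieschangVogtColdewey1980, 5.3.1 (b)] -/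
theorem blockClosed_of_bar (κ : Config φ) {j₁ j₂ : ℕ}
    (hbar : ∀ k, k < κ.w.length → j₁ ≤ k → k < j₂ → j₁ ≤ κ.bar k ∧ κ.bar k < j₂) :
    ∀ x ∈ (κ.w.drop j₁).take (j₂ - j₁), ∀ y ∈ κ.w.take j₁ ++ κ.w.drop j₂, x.1 ≠ y.1 := by
  intro x hx y hy
  obtain ⟨k, hk, hk1, hk2, rfl⟩ := exists_getElem_of_mem_drop_take hx
  have hS : ∀ k, k < κ.w.length → (j₁ ≤ k ∧ k < j₂) → (j₁ ≤ κ.bar k ∧ κ.bar k < j₂) :=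
    fun k hk h => hbar k hk h.1 h.2
  rcases mem_append.1 hy with hy | hy
  · obtain ⟨k', hk', hk'1, rfl⟩ := exists_getElem_of_mem_take hy
    exact κ.fst_ne_of_bar_closed hS hk hk' ⟨hk1, by omega⟩ (by omega)
  · obtain ⟨k', hk', hk'1, rfl⟩ := exists_getElem_of_mem_drop hy
    exact κ.fst_ne_of_bar_closed hS hk hk' ⟨hk1, by omega⟩ (by omega)

/-- **Symbol-closedness of a wrap-around block** (B3): if the partner of every index
`k ∈ [j₁, m) ∪ [0, j₂)` lies again in `[j₁, m) ∪ [0, j₂)`, the cyclic block `w[j₁, m) ++ w[0, j₂)`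
shares no symbol with its complement `w[j₂, j₁)`. [cite: ZieschangVogtColdewey1980, 5.3.1 (b)] -/
theorem wrapBlockClosed_of_bar (κ : Config φ) {j₁ j₂ : ℕ}
    (hbar : ∀ k, k < κ.w.length → (j₁ ≤ k ∨ k < j₂) → (j₁ ≤ κ.bar k ∨ κ.bar k < j₂)) :
    ∀ x ∈ κ.w.drop j₁ ++ κ.w.take j₂, ∀ y ∈ (κ.w.drop j₂).take (j₁ - j₂), x.1 ≠ y.1 := by
  intro x hx y hy
  obtain ⟨k', hk', hk'1, hk'2, rfl⟩ := exists_getElem_of_mem_drop_take hy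
  have hnot : ¬ (j₁ ≤ k' ∨ k' < j₂) := by omega
  rcases mem_append.1 hx with hx | hx
  · obtain ⟨k, hk, hk1, rfl⟩ := exists_getElem_of_mem_drop hx
    exact κ.fst_ne_of_bar_closed hbar hk hk' (Or.inl hk1) hnot
  · obtain ⟨k, hk, hk1, rfl⟩ := exists_getElem_of_mem_take hx
    exact κ.fst_ne_of_bar_closed hbar hk hk' (Or.inr hk1) hnot

/-! ## Absolute vertices of the closed path -/

/-- **Absolute vertex** of position `i` of the closed path `C`: the prefix vertex `pv C i`
translated by the head of the first factor (the closed path starts at the vertex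
`E_0 · head_0 = head_0`). [cite: ZieschangVogtColdewey1980, proof of Thm. 5.3.2] -/
def absv (κ : Config φ) (i : ℕ) : SurfaceGroup g :=
  proj g (FreeGroup.mk (CycFactors.head κ.U 0)) * pv g (CycFactors.closedPath κ.U) i

/-- The absolute vertex of position `0`. [folklore] -/
theorem absv_zero (κ : Config φ) : κ.absv 0 = proj g (FreeGroup.mk (CycFactors.head κ.U 0)) := by
  rw [absv, pv_zero, mul_one]

/-- **Walking along the closed path**: `absv (i + t) = absv i · C[i, i + t)`. [folklore] -/
theorem absv_add (κ : Config φ) (i t : ℕ) :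
    κ.absv (i + t) = κ.absv i *
      proj g (FreeGroup.mk (((CycFactors.closedPath κ.U).drop i).take t)) := by
  rw [absv, absv, pv, pv, take_add, mk_append, map_mul, mul_assoc]

/-- Walking along the closed path, subtraction form. [folklore] -/
theorem absv_eq_absv_mul (κ : Config φ) {a b : ℕ} (hab : a ≤ b) :
    κ.absv b = κ.absv a *
      proj g (FreeGroup.mk (((CycFactors.closedPath κ.U).drop a).take (b - a))) := by
  rw [← absv_add, Nat.add_sub_cancel' hab]

/-- Absolute vertices coincide exactly when the prefix vertices do. [folklore] -/
theorem absv_eq_absv_iff (κ : Config φ) (i j : ℕ) :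
    κ.absv i = κ.absv j ↔ pv g (CycFactors.closedPath κ.U) i = pv g (CycFactors.closedPath κ.U) j :=
  mul_right_inj _

/-- A closed segment `C[a, b)` means equal absolute vertices. [folklore] -/
theorem absv_eq_absv_iff_proj_segment (κ : Config φ) {a b : ℕ} (hab : a ≤ b) :
    κ.absv a = κ.absv b ↔
      proj g (FreeGroup.mk (((CycFactors.closedPath κ.U).drop a).take (b - a))) = 1 := by
  rw [κ.absv_eq_absv_mul hab]
  constructor
  · intro h
    exact mul_eq_left.1 h.symm
  · intro h
    rw [h, mul_one]

/-! ## Kernel start positions and the closed path -/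

/-- `Kstart` is the block offset of the kernels. [folklore] -/
theorem Kstart_eq_blockStart (κ : Config φ) (j : ℕ) :
    κ.Kstart j = CycFactors.blockStart (CycFactors.kernel κ.U) j := rfl

/-- `Kstart` is monotone. [folklore] -/
theorem Kstart_mono (κ : Config φ) {j k : ℕ} (h : j ≤ k) : κ.Kstart j ≤ κ.Kstart k :=
  CycFactors.blockStart_mono _ h

/-- `Kstart (j + 1) = Kstart j + |kernel j|`. [folklore] -/
theorem Kstart_succ_eq (κ : Config φ) (j : ℕ) :
    κ.Kstart (j + 1) = κ.Kstart j + (CycFactors.kernel κ.U j).length :=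
  CycFactors.blockStart_succ _ j

/-- `Kstart m` is the length of the closed path. [folklore] -/
theorem Kstart_length (κ : Config φ) : κ.Kstart κ.w.length = (CycFactors.closedPath κ.U).length := by
  rw [Kstart_eq_blockStart, CycFactors.length_closedPath_eq_blockStart, length_U]

/-- `Kstart j ≤ ℓ` for `j ≤ m`. [folklore] -/
theorem Kstart_le_length (κ : Config φ) {j : ℕ} (hj : j ≤ κ.w.length) :
    κ.Kstart j ≤ (CycFactors.closedPath κ.U).length := by
  rw [← Kstart_length]
  exact κ.Kstart_mono hj

/-- **The closed path up to the kernel of occurrence `j`** is the concatenation of the first `j`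
kernels. [folklore] -/
theorem closedPath_take_Kstart (κ : Config φ) {j : ℕ} (hj : j ≤ κ.w.length) :
    (CycFactors.closedPath κ.U).take (κ.Kstart j) = (List.range j).flatMap (CycFactors.kernel κ.U) := by
  rw [CycFactors.closedPath, Kstart_eq_blockStart]
  exact CycFactors.take_flatMap_range_blockStart _ (by rwa [length_U])

/-- The closed path up to a position inside the kernel of occurrence `j`. [folklore] -/
theorem closedPath_take_Kstart_add (κ : Config φ) {j t : ℕ} (hj : j < κ.w.length)
    (ht : t ≤ (CycFactors.kernel κ.U j).length) :
    (CycFactors.closedPath κ.U).take (κ.Kstart j + t) =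
      (List.range j).flatMap (CycFactors.kernel κ.U) ++ (CycFactors.kernel κ.U j).take t := by
  rw [CycFactors.closedPath, Kstart_eq_blockStart]
  exact CycFactors.take_flatMap_range_blockStart_add _ (by rwa [length_U]) ht

/-- **A segment of the closed path inside one kernel** is the corresponding segment of the
kernel. [folklore] -/
theorem closedPath_drop_Kstart_take (κ : Config φ) {j t : ℕ} (hj : j < κ.w.length)
    (ht : t ≤ (CycFactors.kernel κ.U j).length) :
    ((CycFactors.closedPath κ.U).drop (κ.Kstart j)).take t = (CycFactors.kernel κ.U j).take t := by
  rw [CycFactors.closedPath, Kstart_eq_blockStart]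
  exact CycFactors.take_drop_flatMap_range_blockStart _ (by rwa [length_U]) ht

/-- The kernel of occurrence `j` is the segment `C[Kstart j, Kstart (j+1))`. [folklore] -/
theorem closedPath_drop_Kstart_take_length (κ : Config φ) {j : ℕ} (hj : j < κ.w.length) :
    ((CycFactors.closedPath κ.U).drop (κ.Kstart j)).take (CycFactors.kernel κ.U j).length =
      CycFactors.kernel κ.U j := by
  rw [closedPath_drop_Kstart_take κ hj le_rfl, take_length]

/-! ## Telescoping: occurrences against the closed path -/

/-- The first `j ≤ m` factors read cyclically are the first `j` value words. [folklore] -/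
theorem map_fac_range_eq_take (κ : Config φ) {j : ℕ} (hj : j ≤ κ.w.length) :
    (List.range j).map (CycFactors.fac κ.U) = κ.U.take j := by
  refine ext_getElem ?_ fun i h₁ h₂ => ?_
  · rw [length_map, length_range, length_take, length_U, Nat.min_eq_left hj]
  · have hi : i < κ.U.length := by
      rw [length_take] at h₂
      omega
    rw [getElem_map, getElem_range, getElem_take, CycFactors.fac_eq_getElem _ hi]

/-- The product of the first `j ≤ m` values is the free-group element of the first `j` factors.
[folklore] -/
theorem prod_take_vals_eq_mk_flatMap (κ : Config φ) {j : ℕ} (hj : j ≤ κ.w.length) :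
    (κ.vals.take j).prod = FreeGroup.mk ((List.range j).flatMap (CycFactors.fac κ.U)) := by
  rw [flatMap_def, map_fac_range_eq_take κ hj, ← prod_map_mk, map_take, map_mk_U]

/-- **Telescoping** (free-group level): `v_0 ⋯ v_{j-1} · head_j = head_0 · C[0, Kstart j)` for
`j ≤ m` — the tail of each factor cancels the head of the next.
[cite: ZieschangVogtColdewey1980, proof of Thm. 5.3.2] -/
theorem prod_take_vals_mul_mk_head (κ : Config φ) (hN : CycFactors.CycNielsen κ.U) {j : ℕ}
    (hj : j ≤ κ.w.length) :
    (κ.vals.take j).prod * FreeGroup.mk (CycFactors.head κ.U j) =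
      FreeGroup.mk (CycFactors.head κ.U 0) *
        FreeGroup.mk ((CycFactors.closedPath κ.U).take (κ.Kstart j)) := by
  rw [prod_take_vals_eq_mk_flatMap κ hj, closedPath_take_Kstart κ hj]
  exact hN.mk_flatMap_fac_mul_mk_head j

/-- **The kernel of occurrence `j` starts at the absolute vertex `E_j · head_j`** (V2), for
`j ≤ m` (at `j = m` read `head_m = head_0`, `E_m = proj (value)`).
[cite: ZieschangVogtColdewey1980, proof of Thm. 5.3.2] -/
theorem absv_Kstart (κ : Config φ) (hN : CycFactors.CycNielsen κ.U) {j : ℕ} (hj : j ≤ κ.w.length) :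
    κ.absv (κ.Kstart j) = κ.occStart j * proj g (FreeGroup.mk (CycFactors.head κ.U j)) := by
  rw [absv, pv, ← map_mul, ← prod_take_vals_mul_mk_head κ hN hj, map_mul, occStart]

/-- The start vertex in terms of the absolute vertex of the kernel start. [folklore] -/
theorem occStart_eq_absv_Kstart_mul (κ : Config φ) (hN : CycFactors.CycNielsen κ.U) {j : ℕ}
    (hj : j ≤ κ.w.length) :
    κ.occStart j = κ.absv (κ.Kstart j) * (proj g (FreeGroup.mk (CycFactors.head κ.U j)))⁻¹ := by
  rw [absv_Kstart κ hN hj, mul_inv_cancel_right]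

/-- The head of the `m`-th factor (read cyclically) is the head of the `0`-th. [folklore] -/
theorem head_length (κ : Config φ) : CycFactors.head κ.U κ.w.length = CycFactors.head κ.U 0 := by
  rw [← length_U]
  simpa using CycFactors.head_add_length κ.U 0

/-- The absolute vertex at the end of the closed path. [folklore] -/
theorem absv_Kstart_length (κ : Config φ) (hN : CycFactors.CycNielsen κ.U) :
    κ.absv (κ.Kstart κ.w.length) = proj g κ.value * proj g (FreeGroup.mk (CycFactors.head κ.U 0)) := by
  rw [absv_Kstart κ hN le_rfl, occStart_length, head_length]

/-- `head_j ++ (kernel_j)[0, t) = (fac j)[0, jc (j-1) + t)` for `t` within the kernel. [folklore] -/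
theorem head_append_take_kernel (κ : Config φ) (hN : CycFactors.CycNielsen κ.U) (j : ℕ) {t : ℕ}
    (ht : t ≤ (CycFactors.kernel κ.U j).length) :
    CycFactors.head κ.U j ++ (CycFactors.kernel κ.U j).take t =
      (CycFactors.fac κ.U j).take (CycFactors.jc κ.U (CycFactors.cpred κ.U j) + t) := by
  have hle := hN.jc_add_jc_le j
  rw [CycFactors.length_kernel _ _ hle] at ht
  rw [CycFactors.head, CycFactors.kernel, take_take, Nat.min_eq_left (by omega), ← take_add]

/-- **Absolute vertices inside the kernel of occurrence `j < m`**: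
`absv (Kstart j + t) = E_j · (fac j)[0, jc (j-1) + t)`. [cite: ZieschangVogtColdewey1980, proof of Thm. 5.3.2] -/
theorem absv_Kstart_add (κ : Config φ) (hN : CycFactors.CycNielsen κ.U) {j t : ℕ}
    (hj : j < κ.w.length) (ht : t ≤ (CycFactors.kernel κ.U j).length) :
    κ.absv (κ.Kstart j + t) = κ.occStart j *
      proj g (FreeGroup.mk ((CycFactors.fac κ.U j).take (CycFactors.jc κ.U (CycFactors.cpred κ.U j) + t))) := by
  rw [absv_add, closedPath_drop_Kstart_take κ hj ht, absv_Kstart κ hN hj.le, mul_assoc, ← map_mul,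
    ← mk_append, head_append_take_kernel κ hN j ht]

/-- **The occurrence path** (V2): the absolute vertex of the closed-path position of a slot
`(j, q)` of occurrence `j < m` lying in or at the end of the kernel is `E_j · (fac j)[0, q)` — the
vertex of occurrence `j` after `q` letters. [cite: ZieschangVogtColdewey1980, proof of Thm. 5.3.2] -/
theorem absv_kpos (κ : Config φ) (hN : CycFactors.CycNielsen κ.U) {j q : ℕ} (hj : j < κ.w.length)
    (hq1 : CycFactors.jc κ.U (CycFactors.cpred κ.U j) ≤ q)
    (hq2 : q + CycFactors.jc κ.U j ≤ (CycFactors.fac κ.U j).length) :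
    κ.absv (CycFactors.kpos κ.U (j, q)) = κ.occStart j *
      proj g (FreeGroup.mk ((CycFactors.fac κ.U j).take q)) := by
  have hle := hN.jc_add_jc_le j
  have hlen := CycFactors.length_kernel _ j hle
  have e : CycFactors.kpos κ.U (j, q) =
      κ.Kstart j + (q - CycFactors.jc κ.U (CycFactors.cpred κ.U j)) := rfl
  rw [e, absv_Kstart_add κ hN hj (by rw [hlen]; omega), Nat.add_sub_cancel' hq1]

/-- The vertex of occurrence `j` after all its letters is `E_{j+1}`. [folklore] -/
theorem occStart_mul_proj_fac (κ : Config φ) {j : ℕ} (hj : j < κ.w.length) :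
    κ.occStart j * proj g (FreeGroup.mk (CycFactors.fac κ.U j)) = κ.occStart (j + 1) :=
  (occStart_succ_eq_mul_fac κ hj).symm

/-! ## Spurs at a junction -/

/-- The head of the next factor and the tail cancel (in this order too). [folklore] -/
theorem mk_head_succ_mul_mk_tail (U : List (List (surfaceGen g × Bool))) (j : ℕ) :
    FreeGroup.mk (CycFactors.head U (j + 1)) * FreeGroup.mk (CycFactors.tail U j) = 1 := by
  rw [CycFactors.head_succ_eq_invRev_tail, ← FreeGroup.inv_mk, inv_mul_cancel]

/-- **Spur tip** (V3): `E_{j+1} = absv (Kstart (j+1)) · tail_j` — from the base vertex of the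
junction after occurrence `j < m` the spur `tail_j` leads to the start vertex of occurrence
`j + 1`. [cite: ZieschangVogtColdewey1980, proof of Thm. 5.3.2] -/
theorem occStart_succ_eq_absv_mul_tail (κ : Config φ) (hN : CycFactors.CycNielsen κ.U) {j : ℕ}
    (hj : j < κ.w.length) :
    κ.occStart (j + 1) = κ.absv (κ.Kstart (j + 1)) * proj g (FreeGroup.mk (CycFactors.tail κ.U j)) := by
  rw [absv_Kstart κ hN hj, mul_assoc, ← map_mul, mk_head_succ_mul_mk_tail, map_one, mul_one]

/-- **Spur base** (V3): `absv (Kstart (j+1)) = E_{j+1} · head_{j+1}`. [cite: ZieschangVogtColdewey1980, proof of Thm. 5.3.2] -/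
theorem absv_Kstart_succ_eq_occStart_mul_head (κ : Config φ) (hN : CycFactors.CycNielsen κ.U) {j : ℕ}
    (hj : j < κ.w.length) :
    κ.absv (κ.Kstart (j + 1)) = κ.occStart (j + 1) * proj g (FreeGroup.mk (CycFactors.head κ.U (j + 1))) :=
  absv_Kstart κ hN hj

/-- **Spur base from the left** (V3): `absv (Kstart (j+1)) = E_j · (head_j ++ kernel_j)`.
[cite: ZieschangVogtColdewey1980, proof of Thm. 5.3.2] -/
theorem absv_Kstart_succ_eq_occStart_mul_head_kernel (κ : Config φ) (hN : CycFactors.CycNielsen κ.U)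
    {j : ℕ} (hj : j < κ.w.length) :
    κ.absv (κ.Kstart (j + 1)) = κ.occStart j *
      proj g (FreeGroup.mk (CycFactors.head κ.U j ++ CycFactors.kernel κ.U j)) := by
  rw [Kstart_succ_eq, absv_add, closedPath_drop_Kstart_take_length κ hj, absv_Kstart κ hN hj.le,
    mk_append, map_mul, mul_assoc]

/-- The absolute vertex at `Kend j`. [folklore] -/
theorem absv_Kend (κ : Config φ) (hN : CycFactors.CycNielsen κ.U) {j : ℕ} (hj : j < κ.w.length) :
    κ.absv (κ.Kend j) = κ.occStart j *
      proj g (FreeGroup.mk (CycFactors.head κ.U j ++ CycFactors.kernel κ.U j)) := by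
  rw [← Kstart_succ, absv_Kstart_succ_eq_occStart_mul_head_kernel κ hN hj]

/-- `E_{j+1} = absv (Kend j) · tail_j`. [folklore] -/
theorem occStart_succ_eq_absv_Kend_mul_tail (κ : Config φ) (hN : CycFactors.CycNielsen κ.U) {j : ℕ}
    (hj : j < κ.w.length) :
    κ.occStart (j + 1) = κ.absv (κ.Kend j) * proj g (FreeGroup.mk (CycFactors.tail κ.U j)) := by
  rw [← Kstart_succ, occStart_succ_eq_absv_mul_tail κ hN hj]

/-! ## Block values as head · path segment · head⁻¹ -/

/-- **Block value along the closed path** (free-group level): for `j₁ ≤ j₂ ≤ m`,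
`v_{j₁} ⋯ v_{j₂-1} = head_{j₁} · C[Kstart j₁, Kstart j₂) · head_{j₂}⁻¹`.
[cite: ZieschangVogtColdewey1980, proof of Thm. 5.3.2] -/
theorem prod_block_eq_conj (κ : Config φ) (hN : CycFactors.CycNielsen κ.U) {j₁ j₂ : ℕ}
    (h12 : j₁ ≤ j₂) (h2 : j₂ ≤ κ.w.length) :
    ((κ.vals.drop j₁).take (j₂ - j₁)).prod =
      FreeGroup.mk (CycFactors.head κ.U j₁) *
        FreeGroup.mk (((CycFactors.closedPath κ.U).drop (κ.Kstart j₁)).take (κ.Kstart j₂ - κ.Kstart j₁)) *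
        (FreeGroup.mk (CycFactors.head κ.U j₂))⁻¹ := by
  have h1 := prod_take_vals_mul_mk_head κ hN (h12.trans h2)
  have h2' := prod_take_vals_mul_mk_head κ hN h2
  rw [prod_take_eq_prod_take_mul_prod_block κ h12] at h2'
  have hC : (CycFactors.closedPath κ.U).take (κ.Kstart j₂) =
      (CycFactors.closedPath κ.U).take (κ.Kstart j₁) ++
        ((CycFactors.closedPath κ.U).drop (κ.Kstart j₁)).take (κ.Kstart j₂ - κ.Kstart j₁) := by
    rw [← take_add, Nat.add_sub_cancel' (κ.Kstart_mono h12)]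
  rw [hC, mk_append] at h2'
  rw [eq_mul_inv_iff_mul_eq]
  have e1 : (κ.vals.take j₁).prod =
      FreeGroup.mk (CycFactors.head κ.U 0) * FreeGroup.mk ((CycFactors.closedPath κ.U).take (κ.Kstart j₁)) *
        (FreeGroup.mk (CycFactors.head κ.U j₁))⁻¹ := by
    rw [eq_mul_inv_iff_mul_eq, h1]
  rw [e1] at h2'
  calc ((κ.vals.drop j₁).take (j₂ - j₁)).prod * FreeGroup.mk (CycFactors.head κ.U j₂)
      = (FreeGroup.mk (CycFactors.head κ.U 0) * FreeGroup.mk ((CycFactors.closedPath κ.U).take (κ.Kstart j₁)) *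
          (FreeGroup.mk (CycFactors.head κ.U j₁))⁻¹)⁻¹ *
        ((FreeGroup.mk (CycFactors.head κ.U 0) * FreeGroup.mk ((CycFactors.closedPath κ.U).take (κ.Kstart j₁)) *
          (FreeGroup.mk (CycFactors.head κ.U j₁))⁻¹) *
          ((κ.vals.drop j₁).take (j₂ - j₁)).prod * FreeGroup.mk (CycFactors.head κ.U j₂)) := by
        group
    _ = FreeGroup.mk (CycFactors.head κ.U j₁) *
        FreeGroup.mk (((CycFactors.closedPath κ.U).drop (κ.Kstart j₁)).take (κ.Kstart j₂ - κ.Kstart j₁)) := by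
        rw [h2']
        group

/-- **Block value ending at a junction**: for `j₁ ≤ j + 1 ≤ m`,
`v_{j₁} ⋯ v_j = head_{j₁} · C[Kstart j₁, Kstart (j+1)) · tail_j`.
[cite: ZieschangVogtColdewey1980, proof of Thm. 5.3.2] -/
theorem prod_block_eq_head_mul_tail (κ : Config φ) (hN : CycFactors.CycNielsen κ.U) {j₁ j : ℕ}
    (h12 : j₁ ≤ j + 1) (h2 : j + 1 ≤ κ.w.length) :
    ((κ.vals.drop j₁).take (j + 1 - j₁)).prod =
      FreeGroup.mk (CycFactors.head κ.U j₁) *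
        FreeGroup.mk (((CycFactors.closedPath κ.U).drop (κ.Kstart j₁)).take (κ.Kstart (j + 1) - κ.Kstart j₁)) *
        FreeGroup.mk (CycFactors.tail κ.U j) := by
  rw [prod_block_eq_conj κ hN h12 h2, CycFactors.head_succ_eq_invRev_tail, ← FreeGroup.inv_mk, inv_inv]

/-- **Block value ending at a junction, in `S_g`**: the image of `Ŷ (w[j₁, j+1))` is
`proj (head_{j₁}) · proj (C[Kstart j₁, Kstart (j+1))) · proj (tail_j)`.
[cite: ZieschangVogtColdewey1980, proof of Thm. 5.3.2] -/
theorem proj_lift_block_eq_head_mul_tail (κ : Config φ) (hN : CycFactors.CycNielsen κ.U) {j₁ j : ℕ}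
    (h12 : j₁ ≤ j + 1) (h2 : j + 1 ≤ κ.w.length) :
    proj g (FreeGroup.lift κ.Y (FreeGroup.mk ((κ.w.drop j₁).take (j + 1 - j₁)))) =
      proj g (FreeGroup.mk (CycFactors.head κ.U j₁)) *
        proj g (FreeGroup.mk (((CycFactors.closedPath κ.U).drop (κ.Kstart j₁)).take
          (κ.Kstart (j + 1) - κ.Kstart j₁))) *
        proj g (FreeGroup.mk (CycFactors.tail κ.U j)) := by
  rw [← prod_block_eq_lift, prod_block_eq_head_mul_tail κ hN h12 h2, map_mul, map_mul]

end Config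

end SurfaceGroup

end Literature.Topology.FourManifolds

end
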